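import Summits.CriticalPhenomena.Ising3D.Control2DChiralMono
import Summits.CriticalPhenomena.Ising3D.Control2DVertexAlgebra
import Summits.CriticalPhenomena.Ising3D.Control2DNonVacuity
import Mathlib.Analysis.Analytic.Binomial
import Mathlib.Analysis.SpecialFunctions.Pow.Real
import Mathlib.Tactic.Linarith
import Mathlib.Tactic.Positivity
import Mathlib.Tactic.Ring
import Mathlib.Tactic.FieldSimp
import HarnessLib

/-!
# The sub-power envelope of the chiral block at `x → 1`
(cell `pub-ising3x`, seat controls-1 gen 43; PAPER Appendix E — CONTROL-ONLY; part 1 of 2, part 2 is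
`Control2DUnboundedSpectrum`)

HONEST FRAMING: lottery ticket; floor = tightest certified 3D Ising CFT bounds; no exact-solution
claim without a proof. CONTROL-ONLY (`d = 2`, global `sl(2) × sl(2)` blocks); nothing here is about `d = 3`, no
certificate, functional or number of the record is touched, and no new hypothesis or named fact enters. Pure block
analysis: no `CrossingData` appears in this file.

WHAT THIS FILE ADDS. Every chiral block `k_{2h}(x) = x^h ₂F₁(h,h;2h;x) = Σ_m a_m(h) x^{h+m}` grows slower than ANY
power at `x → 1` (logarithmically, in truth — not proved and not needed):

* `multichoose_eq_ascPochhammer_div`, `multichoose_pos`, `multichoose_succ_rec`, **`hasSum_multichoose_mul_pow`**: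
  the binomial envelope `Σ_m c_m x^m = 1/(1-x)^ε` on `[0,1)`, `c_m = multichoose ε m = C(ε+m-1, m) = (ε)_m/m! > 0`,
  `(m+1) c_{m+1} = (ε+m) c_m` (Mathlib's `Real.one_div_one_sub_rpow_hasFPowerSeriesOnBall_zero`).
* COEFFICIENT DOMINATION: `chiralCoeff_succ_mul_le` — `a_{m+1}(h) c_m ≤ a_m(h) c_{m+1}` as soon as
  `h² ≤ ε (2h+m)`, because `a_{m+1}/a_m = (h+m)²/((m+1)(2h+m))` (`chiralCoeff_succ_rec`) and
  `(h+m)² ≤ (2h+m)(ε+m) ⇔ h² ≤ ε(2h+m)`; iterated from `m₀ ≥ h²/ε` on (`chiralCoeff_mul_le_of_le`); the finitely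
  many earlier indices absorbed into the constant and uniformity in `0 ≤ h ≤ H` by `chiralCoeff_mono`:
  **`exists_chiralCoeff_le_multichoose`** — `∃ K ≥ 0, ∀ h ∈ [0,H], ∀ m, a_m(h) ≤ K c_m`.
* **`exists_chiralBlock_le_envelope`**: `∃ K ≥ 0, ∀ h ∈ [0,H], ∀ x ∈ (0,1), k_{2h}(x) ≤ K/(1-x)^ε` (termwise,
  `x^{h+m} ≤ x^m`, summed by `hasSum_le`).
* On the diagonal of the square, for unitary labels `ℓ ≤ Δ ≤ H` (both weights `h, h̄ ∈ [0, Δ]`):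
  `rpow_le_chiralBlock` (`x^h ≤ k_{2h}(x)`, the leading term), `two_mul_rpow_le_globalBlock_diag`
  (`2x^Δ ≤ g_{Δ,ℓ}(x,x)`), **`exists_globalBlock_diag_le_envelope`** (`g_{Δ,ℓ}(x,x) ≤ 2 (K/(1-x)^ε)²`).

NOT claimed: the logarithmic growth itself, any value of `K`, anything off the real interval `(0,1)`.

References: F. A. Dolan, H. Osborn, Nucl. Phys. B 678 (2004) 491, §3 (`ε = 0` blocks `x^h ₂F₁(h,h;2h;x)`)
[cite: DolanOsborn2004, §3]; G. E. Andrews, R. Askey, R. Roy, *Special Functions* (1999), §2.1 (the `₂F₁` series and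
the binomial series). Tree: `chiralCoeff`, `chiralCoeff_nonneg`, `hasSum_chiralBlock` (`Control2DTermwise`);
`chiralCoeff_mono` (`Control2DChiralMono`); `chiralCoeff_succ_rec`, `chiralCoeff_zero_right` (`Control2DVertexAlgebra`);
`chiralBlock_nonneg` (`Control2DNonVacuity`). Mathlib: `Ring.multichoose`, `Ring.factorial_nsmul_multichoose_eq_ascPochhammer`,
`Ring.multichoose_eq`, `ascPochhammer_pos`, `ascPochhammer_succ_eval`, `Real.one_div_one_sub_rpow_hasFPowerSeriesOnBall_zero`,
`FormalMultilinearSeries.ofScalars_apply_eq`, `hasSum_le`, `le_hasSum`, `Nat.le_induction`, `Finset.single_le_sum`,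
`Real.rpow_le_one`, `Real.rpow_add`.
-/

namespace Summit.CriticalPhenomena.Ising3D.Control2D

open Set

/-! ### The binomial envelope `Σ_m C(ε+m-1, m) x^m = (1-x)^{-ε}` -/

/-- `multichoose ε m = (ε)_m / m!` over `ℝ` (Mathlib's `Ring.factorial_nsmul_multichoose_eq_ascPochhammer`).
[folklore] -/
theorem multichoose_eq_ascPochhammer_div (ε : ℝ) (m : ℕ) :
    Ring.multichoose ε m = (ascPochhammer ℝ m).eval ε / (m.factorial : ℝ) := by
  have h := Ring.factorial_nsmul_multichoose_eq_ascPochhammer ε m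
  rw [Polynomial.ascPochhammer_smeval_eq_eval, nsmul_eq_mul] at h
  have hf : (m.factorial : ℝ) ≠ 0 := by positivity
  rw [eq_div_iff hf, mul_comm]
  exact h

/-- `multichoose ε m > 0` for `ε > 0`. [folklore] -/
theorem multichoose_pos {ε : ℝ} (hε : 0 < ε) (m : ℕ) : 0 < Ring.multichoose ε m := by
  rw [multichoose_eq_ascPochhammer_div]
  exact div_pos (ascPochhammer_pos m ε hε) (by positivity)

/-- The ratio recurrence of the binomial envelope: `(m+1) · multichoose ε (m+1) = (ε+m) · multichoose ε m`.
[folklore] -/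
theorem multichoose_succ_rec (ε : ℝ) (m : ℕ) :
    ((m : ℝ) + 1) * Ring.multichoose ε (m + 1) = (ε + m) * Ring.multichoose ε m := by
  rw [multichoose_eq_ascPochhammer_div, multichoose_eq_ascPochhammer_div, ascPochhammer_succ_eval,
    Nat.factorial_succ]
  have hf : (m.factorial : ℝ) ≠ 0 := by positivity
  push_cast
  field_simp

/-- **The binomial series as an envelope**: for `0 ≤ x < 1`, `Σ_m multichoose ε m · x^m = 1/(1-x)^ε` (Mathlib's
`Real.one_div_one_sub_rpow_hasFPowerSeriesOnBall_zero`, coefficients `C(ε+m-1, m) = multichoose ε m`). [folklore] -/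
theorem hasSum_multichoose_mul_pow (ε : ℝ) {x : ℝ} (hx0 : 0 ≤ x) (hx1 : x < 1) :
    HasSum (fun m : ℕ => Ring.multichoose ε m * x ^ m) (1 / (1 - x) ^ ε) := by
  have habs : |x| < 1 := by rw [abs_lt]; constructor <;> linarith
  have hmem : x ∈ Metric.eball (0 : ℝ) 1 := by
    rw [Metric.mem_eball, edist_zero_right, ← ofReal_norm, Real.norm_eq_abs]
    exact ENNReal.ofReal_lt_one.mpr habs
  have h := (Real.one_div_one_sub_rpow_hasFPowerSeriesOnBall_zero ε).hasSum hmem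
  simp only [zero_add, FormalMultilinearSeries.ofScalars_apply_eq, smul_eq_mul] at h
  refine h.congr_fun fun m => ?_
  rw [Ring.multichoose_eq]

/-! ### Coefficient domination: `a_m(h) ≤ K · multichoose ε m` -/

/-- **One step of the ratio comparison.** For `h > 0`, `ε > 0` and `h² ≤ ε (2h + m)`:
`a_{m+1}(h) · c_m ≤ a_m(h) · c_{m+1}` with `c_m = multichoose ε m` — because
`a_{m+1}/a_m = (h+m)²/((m+1)(2h+m)) ≤ (ε+m)/(m+1) = c_{m+1}/c_m`. [folklore] -/
theorem chiralCoeff_succ_mul_le {h ε : ℝ} (hh : 0 < h) (hε : 0 < ε) {m : ℕ}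
    (hm : h ^ 2 ≤ ε * (2 * h + m)) :
    chiralCoeff h (m + 1) * Ring.multichoose ε m ≤ chiralCoeff h m * Ring.multichoose ε (m + 1) := by
  have hr := chiralCoeff_succ_rec hh m
  have hc := multichoose_succ_rec ε m
  have hpos : 0 < ((m : ℝ) + 1) * (2 * h + m) := by positivity
  have ha : 0 ≤ chiralCoeff h m := chiralCoeff_nonneg hh.le m
  have hcm : 0 ≤ Ring.multichoose ε m := (multichoose_pos hε m).le
  -- multiply the claim by `(m+1)(2h+m) > 0`
  refine le_of_mul_le_mul_left ?_ hpos
  have e1 : ((m : ℝ) + 1) * (2 * h + m) * (chiralCoeff h (m + 1) * Ring.multichoose ε m) =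
      (h + m) ^ 2 * (chiralCoeff h m * Ring.multichoose ε m) := by
    rw [show ((m : ℝ) + 1) * (2 * h + m) * (chiralCoeff h (m + 1) * Ring.multichoose ε m) =
      (((m : ℝ) + 1) * (2 * h + m) * chiralCoeff h (m + 1)) * Ring.multichoose ε m by ring, hr]
    ring
  have e2 : ((m : ℝ) + 1) * (2 * h + m) * (chiralCoeff h m * Ring.multichoose ε (m + 1)) =
      (2 * h + m) * (ε + m) * (chiralCoeff h m * Ring.multichoose ε m) := by
    rw [show ((m : ℝ) + 1) * (2 * h + m) * (chiralCoeff h m * Ring.multichoose ε (m + 1)) =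
      (2 * h + m) * (((m : ℝ) + 1) * Ring.multichoose ε (m + 1)) * chiralCoeff h m by ring, hc]
    ring
  rw [e1, e2]
  have hq : (h + m) ^ 2 ≤ (2 * h + m) * (ε + m) := by nlinarith
  exact mul_le_mul_of_nonneg_right hq (mul_nonneg ha hcm)

/-- **The ratio comparison, iterated**: for `h > 0`, `ε > 0`, `h² ≤ ε m₀` and `m ≥ m₀`,
`a_m(h) · c_{m₀} ≤ a_{m₀}(h) · c_m`. [folklore] -/
theorem chiralCoeff_mul_le_of_le {h ε : ℝ} (hh : 0 < h) (hε : 0 < ε) {m₀ : ℕ} (hm₀ : h ^ 2 ≤ ε * m₀)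
    {m : ℕ} (hm : m₀ ≤ m) :
    chiralCoeff h m * Ring.multichoose ε m₀ ≤ chiralCoeff h m₀ * Ring.multichoose ε m := by
  induction m, hm using Nat.le_induction with
  | base => exact le_rfl
  | succ m hm ih =>
    have hcm : 0 < Ring.multichoose ε m := multichoose_pos hε m
    have hstep : chiralCoeff h (m + 1) * Ring.multichoose ε m ≤ chiralCoeff h m * Ring.multichoose ε (m + 1) := by
      refine chiralCoeff_succ_mul_le hh hε (hm₀.trans ?_)
      have : (m₀ : ℝ) ≤ m := by exact_mod_cast hm
      nlinarith
    -- `a_{m+1} c_{m₀} c_m ≤ a_m c_{m+1} c_{m₀} ≤ a_{m₀} c_m c_{m+1}`, then cancel `c_m > 0`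
    have h1 : chiralCoeff h (m + 1) * Ring.multichoose ε m₀ * Ring.multichoose ε m ≤
        chiralCoeff h m * Ring.multichoose ε m₀ * Ring.multichoose ε (m + 1) := by
      have := mul_le_mul_of_nonneg_right hstep (multichoose_pos hε m₀).le
      linarith [this]
    have h2 : chiralCoeff h m * Ring.multichoose ε m₀ * Ring.multichoose ε (m + 1) ≤
        chiralCoeff h m₀ * Ring.multichoose ε m * Ring.multichoose ε (m + 1) :=
      mul_le_mul_of_nonneg_right ih (multichoose_pos hε (m + 1)).le
    have h3 : chiralCoeff h (m + 1) * Ring.multichoose ε m₀ * Ring.multichoose ε m ≤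
        chiralCoeff h m₀ * Ring.multichoose ε (m + 1) * Ring.multichoose ε m := by linarith
    exact le_of_mul_le_mul_right h3 hcm

/-- **Coefficient domination, uniform on `[0, H]`.** For every `H` and `ε > 0` there is `K ≥ 0` with
`a_m(h) ≤ K · multichoose ε m` for all `0 ≤ h ≤ H` and all `m` (monotonicity of `a_m(h)` in `h`,
`chiralCoeff_mono`, reduces to `h = max H 1`; there the ratio comparison holds from `m₀ = ⌈h²/ε⌉` on, and the
finitely many earlier indices are absorbed into `K`). [folklore] -/
theorem exists_chiralCoeff_le_multichoose (H : ℝ) {ε : ℝ} (hε : 0 < ε) :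
    ∃ K : ℝ, 0 ≤ K ∧ ∀ h : ℝ, 0 ≤ h → h ≤ H → ∀ m : ℕ, chiralCoeff h m ≤ K * Ring.multichoose ε m := by
  set H' : ℝ := max H 1 with hH'
  have hH'pos : 0 < H' := lt_of_lt_of_le one_pos (le_max_right _ _)
  obtain ⟨m₀, hm₀⟩ : ∃ m₀ : ℕ, H' ^ 2 / ε ≤ m₀ := exists_nat_ge _
  have hm₀' : H' ^ 2 ≤ ε * m₀ := by rwa [div_le_iff₀' hε] at hm₀
  -- `K` = sum over the initial segment of `a_j(H') / c_j`
  refine ⟨∑ j ∈ Finset.range (m₀ + 1), chiralCoeff H' j / Ring.multichoose ε j,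
    Finset.sum_nonneg fun j _ => div_nonneg (chiralCoeff_nonneg hH'pos.le j) (multichoose_pos hε j).le, ?_⟩
  intro h h0 hH m
  have hhH' : h ≤ H' := hH.trans (le_max_left _ _)
  have hmono : chiralCoeff h m ≤ chiralCoeff H' m := chiralCoeff_mono h0 hhH' m
  have hcm : 0 < Ring.multichoose ε m := multichoose_pos hε m
  rcases le_or_gt m m₀ with hle | hlt
  · -- initial segment: `a_m(h) ≤ a_m(H') = (a_m(H')/c_m) c_m ≤ K c_m`
    have hj : m ∈ Finset.range (m₀ + 1) := Finset.mem_range.mpr (Nat.lt_succ_of_le hle)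
    have h1 : chiralCoeff H' m = chiralCoeff H' m / Ring.multichoose ε m * Ring.multichoose ε m := by
      field_simp
    calc chiralCoeff h m ≤ chiralCoeff H' m := hmono
      _ = chiralCoeff H' m / Ring.multichoose ε m * Ring.multichoose ε m := h1
      _ ≤ _ := mul_le_mul_of_nonneg_right
          (Finset.single_le_sum (f := fun j => chiralCoeff H' j / Ring.multichoose ε j)
            (fun i _ => div_nonneg (chiralCoeff_nonneg hH'pos.le i) (multichoose_pos hε i).le) hj) hcm.le
  · -- beyond `m₀`: the ratio comparison at `H'`
    have hc0 : 0 < Ring.multichoose ε m₀ := multichoose_pos hε m₀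
    have h2 := chiralCoeff_mul_le_of_le hH'pos hε hm₀' hlt.le
    have h3 : chiralCoeff H' m ≤ chiralCoeff H' m₀ / Ring.multichoose ε m₀ * Ring.multichoose ε m := by
      rw [div_mul_eq_mul_div, le_div_iff₀ hc0]; exact h2
    have hj : m₀ ∈ Finset.range (m₀ + 1) := Finset.mem_range.mpr (Nat.lt_succ_self _)
    calc chiralCoeff h m ≤ chiralCoeff H' m := hmono
      _ ≤ chiralCoeff H' m₀ / Ring.multichoose ε m₀ * Ring.multichoose ε m := h3
      _ ≤ _ := mul_le_mul_of_nonneg_right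
          (Finset.single_le_sum (f := fun j => chiralCoeff H' j / Ring.multichoose ε j)
            (fun i _ => div_nonneg (chiralCoeff_nonneg hH'pos.le i) (multichoose_pos hε i).le) hj) hcm.le

/-! ### The envelope of a chiral block: slower than any power at `x → 1` -/

/-- **Sub-power growth of the chiral block.** For every `H` and `ε > 0` there is `K ≥ 0` with
`k_{2h}(x) ≤ K / (1-x)^ε` for all `0 ≤ h ≤ H` and `0 < x < 1` (termwise: `a_m(h) x^{h+m} ≤ K c_m x^m`, summed
against the binomial series). The true growth is logarithmic; any `ε > 0` suffices below. [folklore] -/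
theorem exists_chiralBlock_le_envelope (H : ℝ) {ε : ℝ} (hε : 0 < ε) :
    ∃ K : ℝ, 0 ≤ K ∧ ∀ h : ℝ, 0 ≤ h → h ≤ H → ∀ x : ℝ, 0 < x → x < 1 →
      chiralBlock h x ≤ K / (1 - x) ^ ε := by
  obtain ⟨K, hK0, hK⟩ := exists_chiralCoeff_le_multichoose H hε
  refine ⟨K, hK0, fun h h0 hH x hx0 hx1 => ?_⟩
  have hS := hasSum_chiralBlock h hx0 hx1
  have hE := (hasSum_multichoose_mul_pow ε hx0.le hx1).mul_left K
  rw [show K * (1 / (1 - x) ^ ε) = K / (1 - x) ^ ε by ring] at hE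
  refine hasSum_le (fun m => ?_) hS hE
  have hxh : x ^ h ≤ 1 := Real.rpow_le_one hx0.le hx1.le h0
  have hxm : 0 ≤ x ^ m := pow_nonneg hx0.le m
  rw [Real.rpow_add hx0, Real.rpow_natCast]
  calc chiralCoeff h m * (x ^ h * x ^ m) ≤ chiralCoeff h m * (1 * x ^ m) :=
        mul_le_mul_of_nonneg_left (mul_le_mul_of_nonneg_right hxh hxm) (chiralCoeff_nonneg h0 m)
    _ = chiralCoeff h m * x ^ m := by ring
    _ ≤ K * Ring.multichoose ε m * x ^ m := mul_le_mul_of_nonneg_right (hK h h0 hH m) hxm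
    _ = K * (Ring.multichoose ε m * x ^ m) := by ring

/-! ### Block bounds on the diagonal -/

/-- `x^h ≤ k_{2h}(x)` on `(0,1)` for `h ≥ 0` (the leading term of a series with non-negative terms). [folklore] -/
theorem rpow_le_chiralBlock {h x : ℝ} (hh : 0 ≤ h) (hx0 : 0 < x) (hx1 : x < 1) : x ^ h ≤ chiralBlock h x := by
  have hs := hasSum_chiralBlock h hx0 hx1
  have h0 : chiralCoeff h 0 * x ^ (h + ((0 : ℕ) : ℝ)) = x ^ h := by
    rw [chiralCoeff_zero_right]; simp
  rw [← h0]
  exact le_hasSum hs 0 (fun m _ => mul_nonneg (chiralCoeff_nonneg hh m) (Real.rpow_nonneg hx0.le _))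

/-- `2 x^Δ ≤ g_{Δ,ℓ}(x,x)` on the diagonal of the square for a unitary label `ℓ ≤ Δ`
(`g(x,x) = 2 k_{2h}(x) k_{2h̄}(x)`, `h + h̄ = Δ`). [folklore] -/
theorem two_mul_rpow_le_globalBlock_diag {Δ : ℝ} {ℓ : ℕ} (hΔ : (ℓ : ℝ) ≤ Δ) {x : ℝ} (hx0 : 0 < x)
    (hx1 : x < 1) : 2 * x ^ Δ ≤ globalBlock Δ ℓ x x := by
  have hℓ : (0 : ℝ) ≤ ℓ := Nat.cast_nonneg ℓ
  have hh : 0 ≤ (Δ + ℓ) / 2 := by linarith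
  have hhb : 0 ≤ (Δ - ℓ) / 2 := by linarith
  have h1 := rpow_le_chiralBlock hh hx0 hx1
  have h2 := rpow_le_chiralBlock hhb hx0 hx1
  have hprod : x ^ Δ ≤ chiralBlock ((Δ + ℓ) / 2) x * chiralBlock ((Δ - ℓ) / 2) x := by
    have e : x ^ Δ = x ^ ((Δ + ℓ) / 2) * x ^ ((Δ - ℓ) / 2) := by
      rw [← Real.rpow_add hx0]; congr 1; ring
    rw [e]
    exact mul_le_mul h1 h2 (Real.rpow_nonneg hx0.le _) (chiralBlock_nonneg hh ⟨hx0, hx1⟩)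
  have hcomm : chiralBlock ((Δ - ℓ) / 2) x * chiralBlock ((Δ + ℓ) / 2) x =
      chiralBlock ((Δ + ℓ) / 2) x * chiralBlock ((Δ - ℓ) / 2) x := mul_comm _ _
  unfold globalBlock
  linarith [hprod, hcomm]

/-- **Block envelope on the diagonal, uniform in the label.** For every `H` and `ε > 0` there is `K ≥ 0` such
that every unitary label `ℓ ≤ Δ ≤ H` has `g_{Δ,ℓ}(x,x) ≤ 2 (K/(1-x)^ε)²` on `(0,1)` (both weights `h, h̄ ≤ Δ ≤ H`).
[folklore] -/
theorem exists_globalBlock_diag_le_envelope (H : ℝ) {ε : ℝ} (hε : 0 < ε) :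
    ∃ K : ℝ, 0 ≤ K ∧ ∀ (Δ : ℝ) (ℓ : ℕ), (ℓ : ℝ) ≤ Δ → Δ ≤ H → ∀ x : ℝ, 0 < x → x < 1 →
      globalBlock Δ ℓ x x ≤ 2 * (K / (1 - x) ^ ε) ^ 2 := by
  obtain ⟨K, hK0, hK⟩ := exists_chiralBlock_le_envelope H hε
  refine ⟨K, hK0, fun Δ ℓ hΔ hH x hx0 hx1 => ?_⟩
  have hℓ : (0 : ℝ) ≤ ℓ := Nat.cast_nonneg ℓ
  have hh : 0 ≤ (Δ + ℓ) / 2 := by linarith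
  have hhb : 0 ≤ (Δ - ℓ) / 2 := by linarith
  have hhH : (Δ + ℓ) / 2 ≤ H := by linarith
  have hhbH : (Δ - ℓ) / 2 ≤ H := by linarith
  have h1 := hK _ hh hhH x hx0 hx1
  have h2 := hK _ hhb hhbH x hx0 hx1
  have hk1 := chiralBlock_nonneg hh ⟨hx0, hx1⟩
  have hk2 := chiralBlock_nonneg hhb ⟨hx0, hx1⟩
  have hprod : chiralBlock ((Δ + ℓ) / 2) x * chiralBlock ((Δ - ℓ) / 2) x ≤
      (K / (1 - x) ^ ε) * (K / (1 - x) ^ ε) := mul_le_mul h1 h2 hk2 (hk1.trans h1)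
  have hcomm : chiralBlock ((Δ - ℓ) / 2) x * chiralBlock ((Δ + ℓ) / 2) x =
      chiralBlock ((Δ + ℓ) / 2) x * chiralBlock ((Δ - ℓ) / 2) x := mul_comm _ _
  unfold globalBlock
  nlinarith [hprod, hcomm]

end Summit.CriticalPhenomena.Ising3D.Control2D
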